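import Summits.RiemannHypothesis.RiemannHypothesis.Theses.UniversalFactor
import Literature.NumberTheory.LFunctions.DeBruijnHDiv

/-!
# RiemannHypothesis / UniversalFactor — the target `LaplaceLoophole`: restatement and kill path

Route `RiemannHypothesis/UniversalFactor`, target item stmt-RiemannHypothesis-2575 (`LaplaceLoophole`,
Cardon's Question 7 made precise): for some `a > 0` the Laplace-smoothed transform
`F_a(z) = ∫₀^∞ Φ(u) (1 + u²/a²)⁻¹ cos(zu) du` of the Pólya–de Bruijn kernel `Φ = deBruijnPhi` has only
real zeros.  The route expects the target to be FALSE and carves the parameter range `a ∈ (0, ∞)`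
into four no-go items.  This file records, once and for all,

* `laplaceLoophole_iff_deBruijnHDiv` — the target is by `Iff.rfl` the statement
  `∃ a > 0, HasOnlyRealZeros (deBruijnHDiv (fun u ↦ 1 + u²/a²))` about the tree's
  `Literature.NumberTheory.LFunctions.deBruijnHDiv` (so every lemma of `DeBruijnHDiv.lean` — entirety,
  the ODE `F_a − F_a''/a² = H_0` — applies verbatim);
* `not_laplaceLoophole_iff` — its negation is `∀ a > 0, ¬ HasOnlyRealZeros F_a`;
* `not_laplaceLoophole_of_noGo` — **the typed kill path**: the four no-go items of the route
  (`NarrowKernelNoGo`: `a ≥ 32`; `MediumKernelNoGo`: `π/8 ≤ a ≤ 32`; `WideKernelNoGo` and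
  `ExceptionalWideNoGo`: `0 < a < π/8` according as `∫₀^∞ H_0(x) cosh(ax) dx ≠ 0` or `= 0`) together
  refute the target (case split at `π/8 < 32`).

No analysis happens here; the content is bookkeeping so that the item closes mechanically (as
`refuted`) the moment the four no-go theorems land.
-/

noncomputable section

namespace Summit.RiemannHypothesis.RiemannHypothesis.Theorems

open Summit.RiemannHypothesis.RiemannHypothesis.Theses.UniversalFactor
open Literature.NumberTheory.LFunctions

/-- The target restated through the tree's `deBruijnHDiv`: `LaplaceLoophole` is literally
`∃ a > 0, HasOnlyRealZeros (deBruijnHDiv (fun u ↦ 1 + u²/a²))` (`deBruijnHDiv_laplace_eq` is `rfl`).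
[folklore] -/
theorem laplaceLoophole_iff_deBruijnHDiv :
    LaplaceLoophole ↔
      ∃ a : ℝ, 0 < a ∧ HasOnlyRealZeros (deBruijnHDiv fun u : ℝ => 1 + u ^ 2 / a ^ 2) :=
  Iff.rfl

/-- The negation of the target: every Laplace smoothing `F_a`, `a > 0`, has a non-real zero.
[folklore] -/
theorem not_laplaceLoophole_iff :
    ¬ LaplaceLoophole ↔
      ∀ a : ℝ, 0 < a → ¬ HasOnlyRealZeros (deBruijnHDiv fun u : ℝ => 1 + u ^ 2 / a ^ 2) := by
  rw [laplaceLoophole_iff_deBruijnHDiv]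
  simp only [not_exists, not_and]

/-- **Kill path of route `UniversalFactor`.** The four no-go items refute the target: for `a ≥ 32`
use `NarrowKernelNoGo`, for `π/8 ≤ a ≤ 32` use `MediumKernelNoGo`, and for `0 < a < π/8` use
`WideKernelNoGo` or `ExceptionalWideNoGo` according as the residue integral
`∫₀^∞ H_0(x) cosh(ax) dx` is non-zero or zero. (Uses only `π/8 < 32`, from `π ≤ 4`.) [folklore] -/
theorem not_laplaceLoophole_of_noGo (hN : NarrowKernelNoGo) (hM : MediumKernelNoGo)
    (hW : WideKernelNoGo) (hE : ExceptionalWideNoGo) : ¬ LaplaceLoophole := by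
  rintro ⟨a, ha, hX⟩
  by_cases h32 : 32 ≤ a
  · exact hN a h32 hX
  by_cases hpi : Real.pi / 8 ≤ a
  · exact hM a hpi (le_of_lt (lt_of_not_ge h32)) hX
  have hlt : a < Real.pi / 8 := lt_of_not_ge hpi
  by_cases hres : (∫ x in Set.Ioi (0:ℝ), deBruijnH 0 (x : ℂ) * (Real.cosh (a * x) : ℂ)) = 0
  · exact hE a ha hlt hres hX
  · exact hW a ha hlt hres hX

/-- The kill path in `deBruijnHDiv` language: under the four no-go items every `F_a`, `a > 0`, has a
non-real zero. [folklore] -/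
theorem not_hasOnlyRealZeros_deBruijnHDiv_laplace_of_noGo (hN : NarrowKernelNoGo)
    (hM : MediumKernelNoGo) (hW : WideKernelNoGo) (hE : ExceptionalWideNoGo) {a : ℝ} (ha : 0 < a) :
    ¬ HasOnlyRealZeros (deBruijnHDiv fun u : ℝ => 1 + u ^ 2 / a ^ 2) :=
  not_laplaceLoophole_iff.1 (not_laplaceLoophole_of_noGo hN hM hW hE) a ha

end Summit.RiemannHypothesis.RiemannHypothesis.Theorems
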